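import Summits.QuantumFields.YangMills.Theorems.BalabanUVNodesN12GuardedLinAvgRightInverse
import Summits.QuantumFields.YangMills.Theorems.BalabanUVNodesN12FlatLinAvgOntoGenSet
import Summits.QuantumFields.YangMills.Theorems.BalabanUVNodesN12GuardedChartDerivIterLin
import Summits.QuantumFields.YangMills.Theorems.BalabanUVNodesN12GuardedLinAvgRightInverseLeft
import Literature.MathematicalPhysics.QuantumFieldTheory.Balaban1983to89.Node00.MultiScaleFibreChartMultiplier
import HarnessLib

/-!
# BalabanUVNodes ∕ N12 — (J-b) module H3: `hsurj` AT THE CHART OF RECORD — module H2b's flat right inverse at `𝐁_k(Z) = Bj M₁ Z k` in module F's `constrEnum`-indexed currency (with a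
# letter), hence a right inverse of `DΦ_{U₀}(0) = fderiv ℝ (msChart F N K k (Bj M₁ Z k) (M˙U₀) U₀) 0` and its SURJECTIVITY at every guarded near-flat background `U₀`

Cell `pub-ymgap` (HUMAN RULINGS D-0062 ∕ D-0149), width seat `pub-ymgap-dag-n10-w1` g3; this closes the seat's LOCATED open item of INBOX l.30547 («`hsurj` at r12's `Bj M₁ Z k`
needs a flat right inverse on the inner-boundary-crossing bonds too») by WAY (ii), in-house: modules H1a∕H1b (straight onto, p615796∕p616977), H2a∕H2b (pins + collar; the bridge to
`qLin j 1`), F (`…N12GuardedLinAvgRightInverse`, p605814: surjectivity persists to curved near-flat backgrounds).  Key K1⁷ `stmt-QuantumFields-20542`, `--kind proof --supports …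
--as helper`; count-neutral; THEOREMS ONLY (0 `def`, 0 `sorry`, 0 `instance`, 0 `notation`).  CONSUMERS (bus l.31383 ∕ l.31645): n12-w4 g3's `hsurj : Function.Surjective (fderiv ℝ
(msChart F N K k (Bj M₁ Z k) (M˙U₀) U₀) 0)` (`exists_lam_msChart_Bj_of_isMinimizer_regMSCoPOfRecord`, `…CurvatureUniform` §3), n12-w3 g2's `hLH`, n12-c g17's J-C package (N) `Rf`∕`hRf`
(function currency; the letter here is an op-norm letter `B` from finite-dimensionality — re-keying to the knit's seminorm `p` ∕ size `q` is the consumer's line).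

CONTENTS.  §1 ★ `exists_flat_rightInverse_enum_of_constrSet` (re-indexing a `ConstrSet`-keyed right inverse of `qLin j 1` by n07-w2's `constrEnum`, + F's `exists_letter_of_linear`),
★★★ `exists_flat_rightInverse_enum_Bj` — module F's DISPLAYED flat input `h₁` AT `Bj M₁ Z k`, DISCHARGED (`2 ≤ M₁`, `k ≤ m + K`, `L^k·M₁ ∣ sitesPerDir 0`), with a letter `B ≥ 0`.
§2 (NODE 00's record, `F : T4Family`) ★★★ `exists_radius_rightInverse_fderiv_msChart_Bj` — `H₁`, `B`, ONE `ρ′ > 0`, and at every `U₀` on 35e's plaquette guard with `‖↑U₀ − 1‖ < ρ′` a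
real-linear `G` with `fderiv ℝ (msChart F N K k (Bj M₁ Z k) (M˙U₀) U₀) 0 (H₁ (G y)) = y`, `‖G y‖ ≤ 2‖y‖`, `‖↑(H₁(G y))‖ ≤ 2B‖y‖` (F §3 `exists_rightInverse_fderiv_msChart_of_flat_letter`);
★★★ `surjective_fderiv_msChart_Bj` — `hsurj` at the chart of record; ★★ `exists_rightInverse_fderiv_msChart_Bj_one` ∕ `surjective_fderiv_msChart_Bj_one` — the same at the flat
background `U₀ = 1` itself (J-C's `Lf := DΦ♭(0)`), guard and radius discharged (n10-w1 g0's `plaqSmall_iter_one`, `coeField_one`).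
§3 ★★ `exists_leftField_rightInverse_Bj` — module G1's LEFT-field currency (n12-w1's `hR` shape, slice `⊤`) at `Bj M₁ Z k`, every guarded near-flat `U₀`.
§4 ★★★ `isFibreChartNear_msChart_Bj` — n07-w2's 35a-socket `IsFibreChartNear` at the chart of record with its right-inverse hypothesis DISCHARGED; ★★★
`hasDerivAt_wilsonAction4_expChart_of_isCritOnFibre_Bj` — [15] (82): curve-critical ⇒ tangent-critical on the multi-scale fibre of record, every guarded near-flat `U₀`.
§5 (v1.1) ★★★ `surjective_fderiv_msChart_Bj_of_agreeOn`, `isFibreChartNear_msChart_Bj_of_agreeOn`, `hasDerivAt_wilsonAction4_expChart_of_isCritOnFibre_Bj_of_agreeOn` — the same three for a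
GENERAL datum `W` with `U₀` in its fibre (the record's `W = M˙(Q_k^{s*}V)`, `U₀` a minimiser), by dag-n12-w4's `msChart_eq_msChart_avgFamily_of_agreeOn`.

HONEST FRAMING.  Composition by name; `ρ′` and `B` EXIST (smoothness constants of modules D∕E near the flat configuration; finite-dimensionality) — print's `O(L²α₀)` small-field radius and
the volume-uniform (46) letter are NOT claimed; the near-flat hypothesis `‖↑U₀ − 1‖ < ρ′` and the plaquette guard are DISPLAYED; nothing of Bałaban's analysis asserted; N12 ∕ N10 ∕ N07 NOT
discharged; K1⁷ NOT closed; count-neutral (typed 28∕28 · discharged 5∕27 unmoved); one finite 𝕋⁴ programme at fixed ε — R4 closes the conditional rung `BalabanLadder.UV` only; the YM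
mass gap (Clay) is NOT proved by any of this; nothing continuum ∕ ℝ⁴ ∕ OS.
-/

noncomputable section

open scoped BigOperators Matrix.Norms.L2Operator

namespace Summit.QuantumFields.YangMills.BalabanUVNodes.N12GuardedLinAvgRightInverseBj

open Literature.MathematicalPhysics.QuantumFieldTheory.Balaban1983to89
open T4Continuum (T4Family)
open ExpMeanLog (deltaSU)
open T4AdjointCovarianceUnitary (lieSU)
open B15DeterminingSets
open B14.Eq213DetSet (Bj)
open B14.Eq213MaximalDomains (side)
open Node00
open Summit.QuantumFields.YangMills.Theorems.BlockAvgCorrector (stokesConst)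
open N12GuardedLinAvgRightInverse (exists_letter_of_linear exists_rightInverse_fderiv_msChart_of_flat_letter surjective_fderiv_msChart_of_flat)
open N12FlatLinAvgOntoGenSet (exists_rightInverse_qLin_one_Bj)
open N12GuardedLinAvgRightInverseLeft (exists_leftField_rightInverse_of_flat)
open BlockAveraging (blockAvg)
open ExpMeanLog (expMeanLogSU)
open T4AdjointCovarianceUnitary (specialUnitaryAd)
open B14.Eq213DetSet (Bj_of_gt)
open Summit.QuantumFields.YangMills.BalabanUVNodes.N07CritTangentConverse (smallBelow_of_plaqSmall)

/-! ## §1  From the `ConstrSet`-indexed right inverse to module F's `constrEnum`-indexed flat input `h₁`, with a letter -/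

section Enum

variable {P : Params} {N : ℕ} [NeZero N]

/-- ★ **RE-INDEXING BY `constrEnum`** (+ the letter, free by finite-dimensionality): a real-linear right inverse of `qLin j 1` on the rows of a determining set `𝔹`, indexed by
`ConstrSet 𝔹 k`, yields module F's displayed flat input — `H₁` on `Fin (constrCard 𝔹 k) → 𝔰𝔲(N)` with `π(qLin j_i 1 (H₁ y) c_i) = y i` — together with a letter `‖↑(H₁ y)‖ ≤ B‖y‖`.
[cite: Balaban1985Variational, (44)-(46) p.285; Balaban1988Convergent, (2.10)-(2.12) p.256] -/
theorem exists_flat_rightInverse_enum_of_constrSet {𝔹 : DetSet P} {k : ℕ} (H : (ConstrSet 𝔹 k → lieSU (Fin N)) →ₗ[ℝ] (PBond P 0 → lieSU (Fin N)))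
    (hH : ∀ (X : ConstrSet 𝔹 k → lieSU (Fin N)) (idx : ConstrSet 𝔹 k), qLin (idx.1 : ℕ) (1 : GaugeField P 0 (SU N)) (H X) idx.2.1 = (X idx : Matrix (Fin N) (Fin N) ℂ)) :
    ∃ H₁ : (Fin (constrCard 𝔹 k) → lieSU (Fin N)) →ₗ[ℝ] (PBond P 0 → lieSU (Fin N)),
      (∀ y i, suProj N (qLin (((constrEnum 𝔹 k).symm i).1 : ℕ) (1 : GaugeField P 0 (SU N)) (H₁ y) ((constrEnum 𝔹 k).symm i).2.1) = y i) ∧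
      ∃ B : ℝ, 0 ≤ B ∧ ∀ y, ‖(fun b => (H₁ y b : Matrix (Fin N) (Fin N) ℂ))‖ ≤ B * ‖y‖ := by
  let H₁ : (Fin (constrCard 𝔹 k) → lieSU (Fin N)) →ₗ[ℝ] (PBond P 0 → lieSU (Fin N)) := H ∘ₗ LinearMap.funLeft ℝ (lieSU (Fin N)) (constrEnum 𝔹 k)
  refine ⟨H₁, fun y i => ?_, exists_letter_of_linear H₁⟩
  have h := hH (y ∘ constrEnum 𝔹 k) ((constrEnum 𝔹 k).symm i)
  simp only [Function.comp_apply, Equiv.apply_symm_apply] at h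
  show suProj N (qLin _ 1 (H (fun idx => y (constrEnum 𝔹 k idx))) _) = y i
  rw [show (fun idx => y (constrEnum 𝔹 k idx)) = y ∘ constrEnum 𝔹 k from rfl, h, suProj_coe]

/-- ★★★ **MODULE F's FLAT INPUT `h₁` AT `𝐁_k(Z)`, DISCHARGED** (`2 ≤ M₁`, `k ≤ m + K`, `L^k·M₁ ∣ sitesPerDir 0`): a real-linear `H₁` with `π(qLin j_i 1 (H₁ y) c_i) = y i` on the
enumerated constrained bonds of levels `≤ k` of `Bj M₁ Z k`, with a letter `B`. [cite: Balaban1985Variational, (44)-(46) p.285; Balaban1988Convergent, (2.13) pp.256-257, (2.10)-(2.12) p.256] -/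
theorem exists_flat_rightInverse_enum_Bj {M₁ k : ℕ} (hM2 : 2 ≤ M₁) (hkK : k ≤ P.m + P.K) {Z : Set (Site P 0)} (hdiv : side P.L M₁ k ∣ P.sitesPerDir 0) :
    ∃ H₁ : (Fin (constrCard (Bj M₁ Z k : DetSet P) k) → lieSU (Fin N)) →ₗ[ℝ] (PBond P 0 → lieSU (Fin N)),
      (∀ y i, suProj N (qLin (((constrEnum (Bj M₁ Z k : DetSet P) k).symm i).1 : ℕ) (1 : GaugeField P 0 (SU N)) (H₁ y)
        ((constrEnum (Bj M₁ Z k : DetSet P) k).symm i).2.1) = y i) ∧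
      ∃ B : ℝ, 0 ≤ B ∧ ∀ y, ‖(fun b => (H₁ y b : Matrix (Fin N) (Fin N) ℂ))‖ ≤ B * ‖y‖ := by
  obtain ⟨H, hH⟩ := exists_rightInverse_qLin_one_Bj (P := P) (N := N) hM2 hkK (Z := Z) hdiv
  exact exists_flat_rightInverse_enum_of_constrSet H hH

end Enum

/-! ## §2  AT NODE 00's CHART OF RECORD: a right inverse of `DΦ_{U₀}(0)` (n12-w3's `hLH`, n12-c's `Rf`) and `hsurj` (n12-w4) at every guarded near-flat `U₀` -/

section Chart

variable {F : T4Family} {N : ℕ} [NeZero N] {K k : ℕ}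

/-- ★★★ **A RIGHT INVERSE OF `DΦ_{U₀}(0)` AT THE CHART OF RECORD `msChart F N K k (Bj M₁ Z k) (M˙U₀) U₀`, WITH LETTERS.**  For `2 ≤ M₁`, `k ≤ m + K`, `L^k·M₁ ∣ sitesPerDir 0`: a
real-linear `H₁` (the flat right inverse, module H2b) with a letter `B ≥ 0`, and ONE radius `ρ′ > 0`, such that at EVERY `U₀` on 35e's plaquette guard with `‖↑U₀ − 1‖ < ρ′` there is
a real-linear `G` with `fderiv ℝ (msChart F N K k (Bj M₁ Z k) (M˙U₀) U₀) 0 (H₁ (G y)) = y` for all `y`, `‖G y‖ ≤ 2‖y‖`, `‖↑(H₁(G y))‖ ≤ 2B‖y‖` (module F §3 ∘ §1).  `ρ′` EXISTS by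
the smoothness constants of modules D∕E near the flat configuration — print's `O(L²α₀)` small-field radius is NOT claimed.
[cite: Balaban1985Variational, (44)-(48) p.285, (82)-(83) p.290; Balaban1988Convergent, (2.13) pp.256-257, (2.10)-(2.12) p.256] -/
theorem exists_radius_rightInverse_fderiv_msChart_Bj {M₁ : ℕ} (hM2 : 2 ≤ M₁) (hkK : k ≤ (F.P K).m + (F.P K).K) {Z : Set (Site (F.P K) 0)}
    (hdiv : side (F.P K).L M₁ k ∣ (F.P K).sitesPerDir 0) :
    ∃ (H₁ : (Fin (constrCard (Bj M₁ Z k : DetSet (F.P K)) k) → lieSU (Fin N)) →ₗ[ℝ] (PBond (F.P K) 0 → lieSU (Fin N))) (B ρ' : ℝ),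
      0 ≤ B ∧ 0 < ρ' ∧ (∀ y, ‖(fun b => (H₁ y b : Matrix (Fin N) (Fin N) ℂ))‖ ≤ B * ‖y‖) ∧
      ∀ ⦃t₀ : ℝ⦄, 0 < t₀ → stokesConst (F.P K) * t₀ < deltaSU (Fin N) →
        ∀ U : GaugeField (F.P K) 0 (SU N), (∀ i, i < k → PlaqSmall t₀ (Averaging.iter (avOfRecord F N K) i U)) → ‖coeField U - 1‖ < ρ' →
          ∃ G : (Fin (constrCard (Bj M₁ Z k : DetSet (F.P K)) k) → lieSU (Fin N)) →ₗ[ℝ] (Fin (constrCard (Bj M₁ Z k : DetSet (F.P K)) k) → lieSU (Fin N)),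
            (∀ y, fderiv ℝ (msChart F N K k (Bj M₁ Z k) (avgFamily (avOfRecord F N K) U) U) 0 (H₁ (G y)) = y) ∧ (∀ y, ‖G y‖ ≤ 2 * ‖y‖) ∧
              ∀ y, ‖(fun b => (H₁ (G y) b : Matrix (Fin N) (Fin N) ℂ))‖ ≤ 2 * B * ‖y‖ := by
  obtain ⟨H₁, h₁, B, hB0, hB⟩ := exists_flat_rightInverse_enum_Bj (P := F.P K) (N := N) hM2 hkK (Z := Z) hdiv
  obtain ⟨ρ', hρ', h⟩ := exists_rightInverse_fderiv_msChart_of_flat_letter (F := F) (Bj M₁ Z k) H₁ h₁ hB0 hB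
  exact ⟨H₁, B, ρ', hB0, hρ', hB, h⟩

/-- ★★★ **`hsurj` AT THE CHART OF RECORD**: for `2 ≤ M₁`, `k ≤ m + K`, `L^k·M₁ ∣ sitesPerDir 0` there is `ρ′ > 0` such that at every `U₀` on the plaquette guard with `‖↑U₀ − 1‖ < ρ′`
the derivative `fderiv ℝ (msChart F N K k (Bj M₁ Z k) (M˙U₀) U₀) 0` is SURJECTIVE (n12-w4's `hsurj`, n12-w3's `hLH`, n12-c's `Rf` at the record).
[cite: Balaban1985Variational, (44)-(48) p.285, (82)-(83) p.290; Balaban1988Convergent, (2.13) pp.256-257] -/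
theorem surjective_fderiv_msChart_Bj {M₁ : ℕ} (hM2 : 2 ≤ M₁) (hkK : k ≤ (F.P K).m + (F.P K).K) {Z : Set (Site (F.P K) 0)}
    (hdiv : side (F.P K).L M₁ k ∣ (F.P K).sitesPerDir 0) :
    ∃ ρ' : ℝ, 0 < ρ' ∧ ∀ ⦃t₀ : ℝ⦄, 0 < t₀ → stokesConst (F.P K) * t₀ < deltaSU (Fin N) →
      ∀ U : GaugeField (F.P K) 0 (SU N), (∀ i, i < k → PlaqSmall t₀ (Averaging.iter (avOfRecord F N K) i U)) → ‖coeField U - 1‖ < ρ' →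
        Function.Surjective (fderiv ℝ (msChart F N K k (Bj M₁ Z k) (avgFamily (avOfRecord F N K) U) U) 0) := by
  obtain ⟨H₁, h₁, -⟩ := exists_flat_rightInverse_enum_Bj (P := F.P K) (N := N) hM2 hkK (Z := Z) hdiv
  exact surjective_fderiv_msChart_of_flat (F := F) (Bj M₁ Z k) H₁ h₁

/-- ★★ **AT THE FLAT BACKGROUND `U₀ = 1` ITSELF** (J-C's `Lf := DΦ♭(0)`, the flat chart with datum `M˙1`): a real-linear right inverse `H` of
`fderiv ℝ (msChart F N K k (Bj M₁ Z k) (M˙1) 1) 0` with a letter (the flat configuration is on the plaquette guard, n10-w1 g0's `plaqSmall_iter_one`, and `‖↑1 − 1‖ = 0 < ρ′`).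
[cite: Balaban1985Variational, (44)-(48) p.285, (82)-(83) p.290; Balaban1988Convergent, (2.13) pp.256-257] -/
theorem exists_rightInverse_fderiv_msChart_Bj_one {M₁ : ℕ} (hM2 : 2 ≤ M₁) (hkK : k ≤ (F.P K).m + (F.P K).K) {Z : Set (Site (F.P K) 0)}
    (hdiv : side (F.P K).L M₁ k ∣ (F.P K).sitesPerDir 0) :
    ∃ (H : (Fin (constrCard (Bj M₁ Z k : DetSet (F.P K)) k) → lieSU (Fin N)) →ₗ[ℝ] (PBond (F.P K) 0 → lieSU (Fin N))) (B : ℝ), 0 ≤ B ∧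
      (∀ y, fderiv ℝ (msChart F N K k (Bj M₁ Z k) (avgFamily (avOfRecord F N K) 1) 1) 0 (H y) = y) ∧
      ∀ y, ‖(fun b => (H y b : Matrix (Fin N) (Fin N) ℂ))‖ ≤ B * ‖y‖ := by
  obtain ⟨H₁, B, ρ', hB0, hρ', -, h⟩ := exists_radius_rightInverse_fderiv_msChart_Bj (F := F) (N := N) (K := K) (k := k) hM2 hkK (Z := Z) hdiv
  obtain ⟨t₀, ht₀, hst⟩ := N12GuardedChartDerivIterLin.exists_stokesThreshold (P := F.P K) (N := N)
  have h1 : ‖coeField (1 : GaugeField (F.P K) 0 (SU N)) - 1‖ < ρ' := by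
    rw [N12GuardedChartDerivIterLin.coeField_one, sub_self, norm_zero]; exact hρ'
  obtain ⟨G, hG, -, hGB⟩ := h ht₀ hst 1 (fun i _ => N12GuardedChartDerivIterLin.plaqSmall_iter_one ht₀ i) h1
  exact ⟨H₁ ∘ₗ G, 2 * B, by positivity, fun y => hG y, fun y => hGB y⟩

/-- ★★ `hsurj` at the flat background `U₀ = 1`. [cite: Balaban1985Variational, (44)-(48) p.285, (82)-(83) p.290] -/
theorem surjective_fderiv_msChart_Bj_one {M₁ : ℕ} (hM2 : 2 ≤ M₁) (hkK : k ≤ (F.P K).m + (F.P K).K) {Z : Set (Site (F.P K) 0)}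
    (hdiv : side (F.P K).L M₁ k ∣ (F.P K).sitesPerDir 0) :
    Function.Surjective (fderiv ℝ (msChart F N K k (Bj M₁ Z k) (avgFamily (avOfRecord F N K) 1) 1) 0) := by
  obtain ⟨H, B, -, hH, -⟩ := exists_rightInverse_fderiv_msChart_Bj_one (F := F) (N := N) (K := K) (k := k) hM2 hkK (Z := Z) hdiv
  exact fun y => ⟨H y, hH y⟩

end Chart

/-! ## §3  Print's LEFT-field currency (module G1) at `𝐁_k(Z)`: n12-w1's `hR` shape at every guarded near-flat background -/

section Left

variable {P : Params} {N : ℕ} [NeZero N]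

/-- ★★ **THE `hR`-SHAPE AT THE RECORD's `𝐁_k(Z)`** (module G1 ∘ §1): for `2 ≤ M₁`, `k ≤ m + K`, `L^k·M₁ ∣ sitesPerDir 0` there is `ρ′ > 0` such that at every `U₀` guarded below `k` with
`‖↑U₀ − 1‖ < ρ′`, EVERY datum `y` on the enumerated constrained bonds of `Bj M₁ Z k` is reached by an `𝔰𝔲(N)`-valued LEFT field `p̂` (`= Ad(U₀)(H₁(G y))`):
`Q_{j_i}(↑U₀)[b ↦ p̂_b·U₀,b](c_i) = ↑Ū^{j_i}(U₀)(c_i) · ↑y_i` — dag-n12-w1's displayed `hR` up to its `SU(2)` coordinates, with the slice `⊤`. [cite: Balaban1985Variational, (44)-(46) p.285] -/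
theorem exists_leftField_rightInverse_Bj {M₁ k : ℕ} (hM2 : 2 ≤ M₁) (hkK : k ≤ P.m + P.K) {Z : Set (Site P 0)} (hdiv : side P.L M₁ k ∣ P.sitesPerDir 0) :
    ∃ ρ' : ℝ, 0 < ρ' ∧ ∀ U₀ : GaugeField P 0 (SU N), SmallBelow (fun j => blockAvg (P := P) (j := j) expMeanLogSU) k U₀ → ‖coeField U₀ - 1‖ < ρ' →
      ∀ y : Fin (constrCard (Bj M₁ Z k : DetSet P) k) → lieSU (Fin N), ∃ p : PBond P 0 → lieSU (Fin N),
        ∀ i, dIterL (((constrEnum (Bj M₁ Z k : DetSet P) k).symm i).1 : ℕ) (coeField U₀)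
            (fun b => (p b : Matrix (Fin N) (Fin N) ℂ) * (U₀ b : Matrix (Fin N) (Fin N) ℂ)) ((constrEnum (Bj M₁ Z k : DetSet P) k).symm i).2.1 =
          ((Averaging.iter (fun j => blockAvg (P := P) (j := j) expMeanLogSU) (((constrEnum (Bj M₁ Z k : DetSet P) k).symm i).1 : ℕ) U₀
              ((constrEnum (Bj M₁ Z k : DetSet P) k).symm i).2.1 : SU N) : Matrix (Fin N) (Fin N) ℂ) * (y i : Matrix (Fin N) (Fin N) ℂ) := by
  obtain ⟨H₁, h₁, -⟩ := exists_flat_rightInverse_enum_Bj (P := P) (N := N) hM2 hkK (Z := Z) hdiv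
  obtain ⟨ρ', hρ', h⟩ := exists_leftField_rightInverse_of_flat (P := P) (N := N) k
    (fun i : Fin (constrCard (Bj M₁ Z k : DetSet P) k) => (((constrEnum (Bj M₁ Z k : DetSet P) k).symm i).1 : ℕ))
    (fun i => Nat.lt_succ_iff.1 ((constrEnum (Bj M₁ Z k : DetSet P) k).symm i).1.2) (fun i => ((constrEnum (Bj M₁ Z k : DetSet P) k).symm i).2.1) H₁ h₁
  refine ⟨ρ', hρ', fun U₀ hsb hU y => ?_⟩
  obtain ⟨p, -, hp⟩ := h U₀ hsb hU y
  exact ⟨p, hp⟩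

end Left

/-! ## §4  35a's fibre chart on the multi-scale fibre OF RECORD and the tangent form (82) at every guarded near-flat background -/

section Tangent

variable {F : T4Family} {N : ℕ} [NeZero N] {K k : ℕ}

/-- ★★★ **n07-w2's `IsFibreChartNear` AT THE CHART OF RECORD, ITS RIGHT-INVERSE SOCKET DISCHARGED**: for `2 ≤ M₁`, `k ≤ m + K`, `L^k·M₁ ∣ sitesPerDir 0` there is `ρ′ > 0` such that for
every `U₀` on 35e's plaquette guard with `‖↑U₀ − 1‖ < ρ′` the canonical chart `msChart F N K k (Bj M₁ Z k) (M˙U₀) U₀` of the fibre of record THROUGH `U₀` is a submersive chart near `0`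
(strictly differentiable, derivative ONTO by §2, level set inside the fibre). [cite: Balaban1985Variational, Sect. C (44)-(48) p.285, (82)-(83) p.290; Balaban1988Convergent, (2.10)-(2.13) pp.256-257] -/
theorem isFibreChartNear_msChart_Bj {M₁ : ℕ} (hM2 : 2 ≤ M₁) (hkK : k ≤ (F.P K).m + (F.P K).K) {Z : Set (Site (F.P K) 0)}
    (hdiv : side (F.P K).L M₁ k ∣ (F.P K).sitesPerDir 0) :
    ∃ ρ' : ℝ, 0 < ρ' ∧ ∀ ⦃t₀ : ℝ⦄, 0 < t₀ → stokesConst (F.P K) * t₀ < deltaSU (Fin N) →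
      ∀ U : GaugeField (F.P K) 0 (SU N), (∀ i, i < k → PlaqSmall t₀ (Averaging.iter (avOfRecord F N K) i U)) → ‖coeField U - 1‖ < ρ' →
        IsFibreChartNear F N K (Bj M₁ Z k) (avgFamily (avOfRecord F N K) U) U (msChart F N K k (Bj M₁ Z k) (avgFamily (avOfRecord F N K) U) U)
          (fderiv ℝ (msChart F N K k (Bj M₁ Z k) (avgFamily (avOfRecord F N K) U) U) 0) := by
  obtain ⟨ρ', hρ', h⟩ := surjective_fderiv_msChart_Bj (F := F) (N := N) (K := K) (k := k) hM2 hkK (Z := Z) hdiv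
  refine ⟨ρ', hρ', fun t₀ ht₀ hst U hsm hU => ?_⟩
  have hsb : SmallBelow (avOfRecord F N K) k U := smallBelow_of_plaqSmall ht₀ hst hsm
  have hfib : AgreeOn (Bj M₁ Z k : DetSet (F.P K)) (avgFamily (avOfRecord F N K) U) (avgFamily (avOfRecord F N K) U) := fun _ _ _ => rfl
  exact ⟨hasStrictFDerivAt_msChart hfib hsb, LinearMap.range_eq_top.2 (h ht₀ hst U hsm hU),
    eventually_agreeOn_of_msChart_eq (fun j hj => Bj_of_gt hj) hfib hsb⟩

/-- ★★★ **[15] (82): CURVE-CRITICAL ⇒ TANGENT-CRITICAL ON THE MULTI-SCALE FIBRE OF RECORD** at every guarded near-flat background (35a's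
`hasDerivAt_wilsonAction4_expChart_of_isCritOnFibre_near` ∘ `isFibreChartNear_msChart_Bj`): if `U₀` is critical for the Wilson action along every curve in its `𝐁_k(Z)`-fibre, then
`d∕dt A(U₀·exp(tX))|₀ = 0` for every `X` in the kernel of `DΦ_{U₀}(0)`. [cite: Balaban1985Variational, (82)-(83) p.290; Balaban1988Convergent, (2.12) p.256] -/
theorem hasDerivAt_wilsonAction4_expChart_of_isCritOnFibre_Bj {M₁ : ℕ} (hM2 : 2 ≤ M₁) (hkK : k ≤ (F.P K).m + (F.P K).K) {Z : Set (Site (F.P K) 0)}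
    (hdiv : side (F.P K).L M₁ k ∣ (F.P K).sitesPerDir 0) :
    ∃ ρ' : ℝ, 0 < ρ' ∧ ∀ ⦃t₀ : ℝ⦄, 0 < t₀ → stokesConst (F.P K) * t₀ < deltaSU (Fin N) →
      ∀ U : GaugeField (F.P K) 0 (SU N), (∀ i, i < k → PlaqSmall t₀ (Averaging.iter (avOfRecord F N K) i U)) → ‖coeField U - 1‖ < ρ' →
        IsCritOnFibre F N K (Bj M₁ Z k) (avgFamily (avOfRecord F N K) U) U →
          ∀ X : PBond (F.P K) 0 → lieSU (Fin N), fderiv ℝ (msChart F N K k (Bj M₁ Z k) (avgFamily (avOfRecord F N K) U) U) 0 X = 0 →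
            HasDerivAt (fun t : ℝ => wilsonAction4 (expChart U (t • X))) 0 0 := by
  obtain ⟨ρ', hρ', h⟩ := isFibreChartNear_msChart_Bj (F := F) (N := N) (K := K) (k := k) hM2 hkK (Z := Z) hdiv
  exact ⟨ρ', hρ', fun t₀ ht₀ hst U hsm hU hcrit X hX => hasDerivAt_wilsonAction4_expChart_of_isCritOnFibre_near (h ht₀ hst U hsm hU) hcrit hX⟩

end Tangent

/-! ## §5 (v1.1)  A GENERAL fibre datum `W` with `U₀` on its fibre — the record's situation (`W = M˙(Q_k^{s*}V)`, `U₀` a minimiser on `𝔅(𝐁_k(Z), W)`): the chart against `W` IS the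
chart against `M˙U₀` (dag-n12-w4's `msChart_eq_msChart_avgFamily_of_agreeOn`), so §2 and §4 transfer verbatim -/

section Datum

variable {F : T4Family} {N : ℕ} [NeZero N] {K k : ℕ}

/-- ★★★ **`hsurj` FOR A GENERAL DATUM**: `ρ′ > 0` such that for every guarded near-flat `U₀` and EVERY multi-scale datum `W` with `U₀` in its `𝐁_k(Z)`-fibre (`AgreeOn (Bj M₁ Z k) (M˙U₀) W`),
`fderiv ℝ (msChart F N K k (Bj M₁ Z k) W U₀) 0` is surjective (`2 ≤ M₁`, `k ≤ m + K`, `L^k·M₁ ∣ sitesPerDir 0`). [cite: Balaban1985Variational, (44)-(48) p.285, (82)-(83) p.290; Balaban1988Convergent, (2.10)-(2.13) pp.256-257] -/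
theorem surjective_fderiv_msChart_Bj_of_agreeOn {M₁ : ℕ} (hM2 : 2 ≤ M₁) (hkK : k ≤ (F.P K).m + (F.P K).K) {Z : Set (Site (F.P K) 0)}
    (hdiv : side (F.P K).L M₁ k ∣ (F.P K).sitesPerDir 0) :
    ∃ ρ' : ℝ, 0 < ρ' ∧ ∀ ⦃t₀ : ℝ⦄, 0 < t₀ → stokesConst (F.P K) * t₀ < deltaSU (Fin N) →
      ∀ U : GaugeField (F.P K) 0 (SU N), (∀ i, i < k → PlaqSmall t₀ (Averaging.iter (avOfRecord F N K) i U)) → ‖coeField U - 1‖ < ρ' →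
        ∀ W : MSField (F.P K) (SU N), AgreeOn (Bj M₁ Z k : DetSet (F.P K)) (avgFamily (avOfRecord F N K) U) W →
          Function.Surjective (fderiv ℝ (msChart F N K k (Bj M₁ Z k) W U) 0) := by
  obtain ⟨ρ', hρ', h⟩ := surjective_fderiv_msChart_Bj (F := F) (N := N) (K := K) (k := k) hM2 hkK (Z := Z) hdiv
  refine ⟨ρ', hρ', fun t₀ ht₀ hst U hsm hU W hW => ?_⟩
  rw [msChart_eq_msChart_avgFamily_of_agreeOn hW]
  exact h ht₀ hst U hsm hU

/-- ★★★ **35a's `IsFibreChartNear` FOR A GENERAL DATUM** at the chart of record: for every guarded near-flat `U₀` in the `𝐁_k(Z)`-fibre of `W`, `msChart F N K k (Bj M₁ Z k) W U₀` is a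
submersive chart of that fibre near `0`. [cite: Balaban1985Variational, Sect. C (44)-(48) p.285, (82)-(83) p.290; Balaban1988Convergent, (2.10)-(2.13) pp.256-257] -/
theorem isFibreChartNear_msChart_Bj_of_agreeOn {M₁ : ℕ} (hM2 : 2 ≤ M₁) (hkK : k ≤ (F.P K).m + (F.P K).K) {Z : Set (Site (F.P K) 0)}
    (hdiv : side (F.P K).L M₁ k ∣ (F.P K).sitesPerDir 0) :
    ∃ ρ' : ℝ, 0 < ρ' ∧ ∀ ⦃t₀ : ℝ⦄, 0 < t₀ → stokesConst (F.P K) * t₀ < deltaSU (Fin N) →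
      ∀ U : GaugeField (F.P K) 0 (SU N), (∀ i, i < k → PlaqSmall t₀ (Averaging.iter (avOfRecord F N K) i U)) → ‖coeField U - 1‖ < ρ' →
        ∀ W : MSField (F.P K) (SU N), AgreeOn (Bj M₁ Z k : DetSet (F.P K)) (avgFamily (avOfRecord F N K) U) W →
          IsFibreChartNear F N K (Bj M₁ Z k) W U (msChart F N K k (Bj M₁ Z k) W U) (fderiv ℝ (msChart F N K k (Bj M₁ Z k) W U) 0) := by
  obtain ⟨ρ', hρ', h⟩ := surjective_fderiv_msChart_Bj_of_agreeOn (F := F) (N := N) (K := K) (k := k) hM2 hkK (Z := Z) hdiv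
  refine ⟨ρ', hρ', fun t₀ ht₀ hst U hsm hU W hW => ?_⟩
  have hsb : SmallBelow (avOfRecord F N K) k U := smallBelow_of_plaqSmall ht₀ hst hsm
  exact ⟨hasStrictFDerivAt_msChart hW hsb, LinearMap.range_eq_top.2 (h ht₀ hst U hsm hU W hW),
    eventually_agreeOn_of_msChart_eq (fun j hj => Bj_of_gt hj) hW hsb⟩

/-- ★★★ **[15] (82) ON THE FIBRE OF A GENERAL DATUM OF RECORD**: a guarded near-flat `U₀` in the `𝐁_k(Z)`-fibre of `W`, critical for the Wilson action along every curve in that fibre, is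
tangent-critical: `d∕dt A(U₀·exp(tX))|₀ = 0` for every `X` in the kernel of `DΦ_{U₀}(0)` (the situation of a MINIMISER `U₀` of (2.12) on `𝔅(𝐁_k(Z), M˙(Q_k^{s*}V))`).
[cite: Balaban1985Variational, (82)-(83) p.290; Balaban1988Convergent, (2.12) p.256] -/
theorem hasDerivAt_wilsonAction4_expChart_of_isCritOnFibre_Bj_of_agreeOn {M₁ : ℕ} (hM2 : 2 ≤ M₁) (hkK : k ≤ (F.P K).m + (F.P K).K)
    {Z : Set (Site (F.P K) 0)} (hdiv : side (F.P K).L M₁ k ∣ (F.P K).sitesPerDir 0) :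
    ∃ ρ' : ℝ, 0 < ρ' ∧ ∀ ⦃t₀ : ℝ⦄, 0 < t₀ → stokesConst (F.P K) * t₀ < deltaSU (Fin N) →
      ∀ U : GaugeField (F.P K) 0 (SU N), (∀ i, i < k → PlaqSmall t₀ (Averaging.iter (avOfRecord F N K) i U)) → ‖coeField U - 1‖ < ρ' →
        ∀ W : MSField (F.P K) (SU N), AgreeOn (Bj M₁ Z k : DetSet (F.P K)) (avgFamily (avOfRecord F N K) U) W →
          IsCritOnFibre F N K (Bj M₁ Z k) W U →
            ∀ X : PBond (F.P K) 0 → lieSU (Fin N), fderiv ℝ (msChart F N K k (Bj M₁ Z k) W U) 0 X = 0 →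
              HasDerivAt (fun t : ℝ => wilsonAction4 (expChart U (t • X))) 0 0 := by
  obtain ⟨ρ', hρ', h⟩ := isFibreChartNear_msChart_Bj_of_agreeOn (F := F) (N := N) (K := K) (k := k) hM2 hkK (Z := Z) hdiv
  exact ⟨ρ', hρ', fun t₀ ht₀ hst U hsm hU W hW hcrit X hX => hasDerivAt_wilsonAction4_expChart_of_isCritOnFibre_near (h ht₀ hst U hsm hU W hW) hcrit hX⟩

end Datum

end Summit.QuantumFields.YangMills.BalabanUVNodes.N12GuardedLinAvgRightInverseBj

end
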